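import Summits.QuantumFields.BalabanUV.T4Continuum.Support.TermwiseResidualWitnessLedger

/-!
# TermwiseResidualWitnessTower — leaf S.5 of road P1 for row NE7, file 4: the two-run RATE inputs (W-rate-0)∕(W-rate-t)
# of `TermwiseResidualWitness(Ledger)` ARE node T's existing socket `URateUpTo` READ AT THE REFERENCE WITNESS — for a
# `t`-indexed family of step functionals (H2's extended format) no new socket shape is asked of rows NE5∕NE9

Cell `pub-balaban`, rung (B)+1 sub-cell t4, lineage `b2b-balaban-t4-ne7-p1` (node U5 = NE7, TERM-WISE member;
generation 19), skeleton `HOME/t4/b2b-balaban-t4-ne7-p1-g19/SKELETON-NE7-P1.md` v1.7 §2 leaf S.5 ∕ NODE T, record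
`t4/T4-EST-NE7-P1.md` §25; companions `Support/TermwiseResidualWitness`, `Support/TermwiseResidualWitnessLedger`,
`Support/TermwiseLocalThm1LedgerW`.  HONEST FRAMING (page 1): FIXED FINITE T⁴, rung (B)+1 = the `ε → 0` limit of
unit-scale averaged expectations, CONDITIONAL on BetaPertH and the nine spine estimates (0/9 proved); NOT infinite
volume, NOT a mass gap, NOT the Clay problem.  NE7 is NOT PRINTED in [Balaban1984PropagatorsI]–[Balaban1989LargeFieldII]
and NOT proved here.  `URateUpTo` (lineage gen 1, `T4TowerRateComposition`) is the cell's two-run RATE SHAPE — NOT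
PRINTED; it is PRODUCED in kernel from rows NE3∕NE4∕NE5∕NE9's sockets by `T4TowerRateDischarge.uRateUpTo_of_nodes`
(conditional on those rows).  Everything below is a HYPOTHESIS BINDER named in the statement; the theorems are
[folklore] (triangle inequality + instantiation at the witness).  No definitions, no cite tags; nothing printed asserted.

WHY (record §25 (25e), skeleton v1.7 S.5 classes).  Files 1–3 produce the END's residual-witness binders from eight
inputs, two of which are TWO-RUN RATES of the field-independent step constants `vc·(K,t,X)`:
(W-rate-0) `|vc_B(K,0,X) − vc_A(K,0,X)| ≤ CrW·θ′^{scale X}·e^{−κd(X)}` on both ledgers, and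
(W-rate-t) `|(vc_B(K,t,X) − vc_B(K,0,X)) − (vc_A(K,t,X) − vc_A(K,0,X))| ≤ CrW·θ′^{scale X}·e^{−κd(X)}` on the near-support
sub-ledger — booked as «ROW NE5, the named ask of journal l.4888: the step-map closeness evaluated at the trivial
background, as a function of `t`».  This file shows the ask is NOT a new socket shape: when the step constants are the
VALUES AT THE TRIVIAL BACKGROUND of a `t`-indexed family of step functionals, `vc·(K,t,X) = E·ᵗ(g·_K, 1·, X)` (the format
in which H2 = (B^μ) carries the observable: the same functionals the E-kind ledger uses, now depending on the source `t`),
then (W-rate-0) is `URateUpTo K (E_Aᵗ⁼⁰) (E_Bᵗ⁼⁰) …` evaluated at the reference witness `v₁ ∈ Adm` with `u_A v₁ = 1_A`,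
`u_B v₁ = 1_B` (the END's binder `hwit`, node T.6), constant `CrW = Cr`, and (W-rate-t) follows from `URateUpTo` at `t`
and at `0` by the triangle inequality, constant `2·Cr` (no `|t|`-gain is needed: the END quantifies `|t| ≤ l₀` and its
radii are `t`-free).  So S.5's ROW input = NODE T's tower `hUR`, asked for the `t`-family `|t| ≤ l₀` instead of one
functional — exactly what H2's extended format means for node T; producers unchanged (`uRateUpTo_of_nodes` per `t`).

WHAT IS PROVED ([folklore]).
§1 `rate0_of_uRateUpTo_witness` — `URateUpTo K EA EB gA gB uA uB Adm Cr θ κ` + a witness `v₁ ∈ Adm`, `uA v₁ = oneA`,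
   `uB v₁ = oneB` ⇒ `|EB gB oneB X − EA gA oneA X| ≤ Cr·θ^{scale X}·e^{−κd X}` for `scale X ≤ K`;
   `ratet_of_uRateUpTo_witness` — the same for two members `t`, `0` of a family ⇒ the t-discrepancy's two-run rate with
   constant `2·Cr`.
§2 **`wRates_of_uRateUpTo_family`** — the (W-rate-0) (both ledgers) and (W-rate-t) hypotheses of
   `TermwiseResidualWitness.residualWitness_of_format` ∕ `TermwiseLocal.goodClause_summable_UN_levels_of_thm1At_residualW`
   PRODUCED VERBATIM (with `CrW := 2·Cr`, weight `e^{−κd}`, scale `C.scale`) for `vc· K t X := E·ᵗ (g· K) one· X` from: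
   `hURt : ∀ K t, |t| ≤ l₀ → URateUpTo K (EAt t) (EBt t) (gA K) (gB K) (uA K) (uB K) Adm Cr θ′ κ`, `hl₀ : 0 ≤ l₀` (so
   `t = 0` is a member), the END's `hwit`, and the ledgers' scale bounds (W-sc).
§3 `toy_wRates` — non-vacuity on the lineage's `toyCarriers`: a genuinely `t`-dependent two-run family meeting `hURt` with
   the runs different at the trivial background.

NOT DELIVERED: `URateUpTo` for Bałaban's `t`-dressed functionals (rows NE3∕NE4∕NE5∕NE9 under H2 — node T); the one-run
size (W-size); the format (W-fmt)∕(W-loc) (NODE F).  NOT NE7 (spine 0/9 unchanged), NOT summit progress.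
-/

noncomputable section

open Finset
open scoped BigOperators

namespace Summit.QuantumFields.BalabanUV.T4Continuum.TermwiseResidualWitness

open Literature.MathematicalPhysics.QuantumFieldTheory.Balaban1983to89
open T4OutputRate (Carriers Functional)
open T4TowerRateComposition (URateUpTo)
open T4RecentScale (Multiplicity)

/-! ## §1 The socket read at the witness -/

section Witness

variable {C : Carriers} {V : Type*}

/-- **(W-rate-0) IS `URateUpTo` AT THE WITNESS.**  The two-run rate of node T, evaluated at a reference datum `v₁ ∈ Adm`
whose backgrounds are the trivial ones, is the two-run rate of the step functionals' VALUES AT THE TRIVIAL BACKGROUND —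
the field-independent step constants of leaf S.5. [folklore] -/
theorem rate0_of_uRateUpTo_witness {EA : Functional C C.BgA} {EB : Functional C C.BgB} {gA gB : ℕ → ℝ}
    {uA : V → C.BgA} {uB : V → C.BgB} {Adm : Set V} {Cr θ κ : ℝ} {K : ℕ}
    (h : URateUpTo K EA EB gA gB uA uB Adm Cr θ κ) {oneA : C.BgA} {oneB : C.BgB}
    (hwit : ∃ v₁ ∈ Adm, uA v₁ = oneA ∧ uB v₁ = oneB) (X : C.Dom) (hX : C.scale X ≤ K) :
    |EB gB oneB X - EA gA oneA X| ≤ Cr * θ ^ C.scale X * Real.exp (-(κ * C.d X)) := by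
  obtain ⟨v₁, hv₁, hA, hB⟩ := hwit
  rw [abs_sub_comm, ← hA, ← hB]
  exact h v₁ hv₁ X hX

/-- **(W-rate-t) FROM `URateUpTo` AT TWO MEMBERS OF A FAMILY.**  For the members `t` and `0` of a `t`-indexed family of
two-run step functionals, each obeying `URateUpTo` with constant `Cr`, the t-DISCREPANCY of the values at the trivial
background has the two-run rate with constant `2·Cr` (triangle inequality). [folklore] -/
theorem ratet_of_uRateUpTo_witness {EAt : ℝ → Functional C C.BgA} {EBt : ℝ → Functional C C.BgB} {gA gB : ℕ → ℝ}
    {uA : V → C.BgA} {uB : V → C.BgB} {Adm : Set V} {Cr θ κ : ℝ} {K : ℕ} {t : ℝ}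
    (ht : URateUpTo K (EAt t) (EBt t) gA gB uA uB Adm Cr θ κ) (h0 : URateUpTo K (EAt 0) (EBt 0) gA gB uA uB Adm Cr θ κ)
    {oneA : C.BgA} {oneB : C.BgB} (hwit : ∃ v₁ ∈ Adm, uA v₁ = oneA ∧ uB v₁ = oneB) (X : C.Dom) (hX : C.scale X ≤ K) :
    |(EBt t gB oneB X - EBt 0 gB oneB X) - (EAt t gA oneA X - EAt 0 gA oneA X)|
      ≤ 2 * Cr * θ ^ C.scale X * Real.exp (-(κ * C.d X)) := by
  have h1 := rate0_of_uRateUpTo_witness ht hwit X hX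
  have h2 := rate0_of_uRateUpTo_witness h0 hwit X hX
  have e : (EBt t gB oneB X - EBt 0 gB oneB X) - (EAt t gA oneA X - EAt 0 gA oneA X)
      = (EBt t gB oneB X - EAt t gA oneA X) - (EBt 0 gB oneB X - EAt 0 gA oneA X) := by ring
  rw [e]
  calc |(EBt t gB oneB X - EAt t gA oneA X) - (EBt 0 gB oneB X - EAt 0 gA oneA X)|
      ≤ |EBt t gB oneB X - EAt t gA oneA X| + |EBt 0 gB oneB X - EAt 0 gA oneA X| := abs_sub _ _
    _ ≤ Cr * θ ^ C.scale X * Real.exp (-(κ * C.d X)) + Cr * θ ^ C.scale X * Real.exp (-(κ * C.d X)) := add_le_add h1 h2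
    _ = 2 * Cr * θ ^ C.scale X * Real.exp (-(κ * C.d X)) := by ring

end Witness

/-! ## §2 The (W-rate-0)∕(W-rate-t) hypotheses of files 2–3 PRODUCED from node T's tower for the `t`-family -/

section Indexed

variable {C : Carriers} {ι' : Type} {σ : Type*} [DecidableEq σ] {l₀ : ℝ} {T : ℕ → Finset σ}
  {Bad : ℕ → ℝ → Finset σ} {Adm : Set ι'}

/-- **S.5's ROW INPUTS = NODE T's SOCKET FOR THE `t`-FAMILY.**  Let the field-independent step constants of the residual-
proper factor be the values at the trivial backgrounds of a `t`-indexed family of step functionals,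
`vc· K t X := E·ᵗ (g· K) one· X`.  IF `hURt`: for every cutoff `K` and source `|t| ≤ l₀` the family member obeys node T's
two-run rate `URateUpTo K (EAᵗ) (EBᵗ) (gA K) (gB K) (uA K) (uB K) Adm Cr θ′ κ` (the E-kind tower `hUR` of the END, asked
per `t` — H2's extended format), `0 ≤ l₀`, and `hwit` (the END's reference witness, node T.6) — THEN the three rate
hypotheses of `residualWitness_of_format` ∕ `goodClause_summable_UN_levels_of_thm1At_residualW` hold VERBATIM with
`CrW := 2·Cr`: (W-rate-t) on any sub-ledger of domains with scales `≤ K`, (W-rate-0) on the term ledger and on the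
reference ledger.  Nothing printed is asserted; `URateUpTo` is a hypothesis. [folklore] -/
theorem wRates_of_uRateUpTo_family (EAt : ℝ → Functional C C.BgA) (EBt : ℝ → Functional C C.BgB)
    (gA gB : ℕ → ℕ → ℝ) (uA : ℕ → ι' → C.BgA) (uB : ℕ → ι' → C.BgB) (oneA : C.BgA) (oneB : C.BgB)
    (wfac nf : ℕ → ℝ → σ → Finset C.Dom) (wfac₀ : ℕ → Finset C.Dom) {Cr θ' κ : ℝ} (hCr : 0 ≤ Cr) (hθ' : 0 ≤ θ')
    (hl₀ : 0 ≤ l₀)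
    (hURt : ∀ K t, |t| ≤ l₀ → URateUpTo K (EAt t) (EBt t) (gA K) (gB K) (uA K) (uB K) Adm Cr θ' κ)
    (hwit : ∀ K, ∃ v₁ ∈ Adm, uA K v₁ = oneA ∧ uB K v₁ = oneB)
    (hsc : ∀ K t, |t| ≤ l₀ → ∀ τ ∈ T K \ Bad K t, ∀ X ∈ wfac K t τ, C.scale X ≤ K)
    (hscF : ∀ K t, |t| ≤ l₀ → ∀ τ ∈ T K \ Bad K t, ∀ X ∈ nf K t τ, C.scale X ≤ K)
    (hsc₀ : ∀ K, ∀ X ∈ wfac₀ K, C.scale X ≤ K) :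
    (∀ K t, |t| ≤ l₀ → ∀ τ ∈ T K \ Bad K t, ∀ X ∈ wfac K t τ, X ∈ nf K t τ →
      |(EBt t (gB K) oneB X - EBt 0 (gB K) oneB X) - (EAt t (gA K) oneA X - EAt 0 (gA K) oneA X)|
        ≤ 2 * Cr * θ' ^ C.scale X * Real.exp (-(κ * C.d X))) ∧
    (∀ K t, |t| ≤ l₀ → ∀ τ ∈ T K \ Bad K t, ∀ X ∈ wfac K t τ,
      |EBt 0 (gB K) oneB X - EAt 0 (gA K) oneA X| ≤ 2 * Cr * θ' ^ C.scale X * Real.exp (-(κ * C.d X))) ∧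
    (∀ K, ∀ X ∈ wfac₀ K,
      |EBt 0 (gB K) oneB X - EAt 0 (gA K) oneA X| ≤ 2 * Cr * θ' ^ C.scale X * Real.exp (-(κ * C.d X))) := by
  have h0 : ∀ K, URateUpTo K (EAt 0) (EBt 0) (gA K) (gB K) (uA K) (uB K) Adm Cr θ' κ :=
    fun K => hURt K 0 (by simpa using hl₀)
  -- one rate `Cr` is below the produced constant `2·Cr`
  have hup : ∀ X : C.Dom, Cr * θ' ^ C.scale X * Real.exp (-(κ * C.d X))
      ≤ 2 * Cr * θ' ^ C.scale X * Real.exp (-(κ * C.d X)) := fun X => by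
    have : 0 ≤ Cr * θ' ^ C.scale X * Real.exp (-(κ * C.d X)) :=
      mul_nonneg (mul_nonneg hCr (pow_nonneg hθ' _)) (Real.exp_pos _).le
    linarith
  refine ⟨fun K t ht τ hτ X _ hXn => ?_, fun K t ht τ hτ X hX => ?_, fun K X hX => ?_⟩
  · exact ratet_of_uRateUpTo_witness (hURt K t ht) (h0 K) (hwit K) X (hscF K t ht τ hτ X hXn)
  · exact (rate0_of_uRateUpTo_witness (h0 K) (hwit K) X (hsc K t ht τ hτ X hX)).trans (hup X)
  · exact (rate0_of_uRateUpTo_witness (h0 K) (hwit K) X (hsc₀ K X hX)).trans (hup X)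

end Indexed

/-! ## §3 Non-vacuity -/

section Toy

open T4TowerRateComposition (toyCarriers)

/-- On the lineage's toy carriers (`T4TowerRateComposition.toyCarriers`: domains `ℕ` labelled by their scale, `d ≡ 0`,
backgrounds `ℝ`) a `t`-indexed two-run family — run A's functional `Eᵗ_A(g,U,j) = U`, run B's
`Eᵗ_B(g,U,j) = U + t·(1/2)^j` — obeys `URateUpTo 1` for every `|t| ≤ 1` with `Cr = 1`, `θ = 1/2`, `κ = 0`, `Adm = univ`,
`u_A = u_B = id`, and at the trivial backgrounds `1` the two runs DIFFER `t`-dependently (`vc_B − vc_A = t·(1/2)^j`,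
`= 1/2` at `t = 1`, `j = 1`): the hypotheses of `wRates_of_uRateUpTo_family` are jointly inhabited by a genuinely
`t`-dependent family. [folklore] -/
theorem toy_wRates :
    (∀ t : ℝ, |t| ≤ 1 →
      URateUpTo (C := toyCarriers) (V := ℝ) 1 (fun _ U _ => U) (fun _ U j => U + t * (1 / 2) ^ j)
        (fun _ => 1) (fun _ => 1) id id Set.univ 1 (1 / 2) 0) ∧
    ((fun (_ : ℕ → ℝ) (U : ℝ) (j : ℕ) => U + (1 : ℝ) * (1 / 2) ^ j) (fun _ => 1) 1 1
        - (fun (_ : ℕ → ℝ) (U : ℝ) (_ : ℕ) => U) (fun _ => 1) 1 1 = 1 / 2) := by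
  refine ⟨fun t ht v _ X _ => ?_, by norm_num⟩
  show |v - (v + t * (1 / 2) ^ X)| ≤ 1 * (1 / 2) ^ X * Real.exp (-(0 * (0 : ℝ)))
  rw [show (v : ℝ) - (v + t * (1 / 2) ^ X) = -(t * (1 / 2) ^ X) by ring, abs_neg, abs_mul,
    abs_of_nonneg (by positivity : (0 : ℝ) ≤ (1 / 2) ^ X), zero_mul, neg_zero, Real.exp_zero, mul_one, one_mul]
  exact mul_le_of_le_one_left (by positivity) ht

end Toy

end Summit.QuantumFields.BalabanUV.T4Continuum.TermwiseResidualWitness
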